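import Literature.MathematicalPhysics.QuantumFieldTheory.Balaban1983to89.B12Membership314
import Literature.Analysis.Complex.LogOnePlus

/-!
# Bałaban, *Renormalization group approach to lattice gauge field theories. I* (CMP 109, 1987), p. 272, the sentence
# before (3.14): condition (ii) (1.13) of the space `U^c_j` for the product configuration `exp iξ𝐀·𝐔` — KERNEL-CHECKED
# via the logarithm `A″ = (iξ)⁻¹ log(e^{iξ𝐀} e^{iξA′})` (conjugation-equivariant BCH remainder with Lipschitz bounds) and an
# EXPLICIT restriction on `α₂`

Sources reproduced (statement level + kernel bookkeeping; nothing of the series is asserted):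

* T. Bałaban, *Renormalization group approach to lattice gauge field theories. I. Generation of effective actions in
  a small field approximation and a coupling constant renormalization in four dimensions*, Commun. Math. Phys.
  **109** (1987) 249–301 [`Balaban1987RG1` = B12; renders `b2b-balaban-ref1/pages/1987-cmp109-rg-I-small-field/…-p014-x4.png`
  (p. 262) and `…-p024-x4.png` (p. 272) re-read as images for this module].

  p. 262 [PDF 14], verbatim: *"The space U^c_j(X, α₀, α₁, γ₀) is a union of orbits [(𝐔, 𝐉)] determined by configurations
  𝐔, 𝐉 satisfying the four conditions written below. (i) 𝐔 = U′U, U has values in the group G, |∂U − 1| < α₀ξ² on X, (1.11)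
  … (ii) U′ = exp iξA′, A′ has values in the algebra 𝔤ᶜ, |A′|, |∇^ξ_U A′| < α₁ on X. (1.13) (iii) The configurations 𝐔, 𝐉
  satisfy the bounds |∂𝐔 − 1| < α₀ξ², |𝐉| < γ₀ on X. (1.14)"* — in (1.13) the covariant derivative is with respect to the
  `G`-valued factor `U` (plain letter), re-read on the render.

  p. 272 [PDF 24], verbatim: *"𝐄^{(j)}(X, exp iξ𝐀𝐔, (L^{j−1}η)³𝐉 + Δ^ξ_𝐔𝐀 − P₁𝐀 + 𝐅₁(𝐔, 𝐀)). (3.13) We consider it on the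
  space U^c_j(X, 1/2α₀, 1/2α₁, α₀) (notice the different constant in the bound for 𝐉). It is an analytic function on this
  space, and also an analytic function of 𝐀, for 𝐀, ∇^ξ_𝐔𝐀, Δ^ξ_𝐔𝐀 sufficiently small. These restrictions can be easily
  obtained from the definition of the spaces, and from the form of the expressions in (3.13). Thus, there exists a constant
  α₂, depending on α₀ and on some absolute constants, such that the function (3.13) is analytic in 𝐀, for 𝐀 satisfying the
  conditions |𝐀|, |P₁𝐀|, |∇^ξ_𝐔𝐀|, |Δ^ξ_𝐔𝐀| < α₂ on X. (3.14)"* — in (3.14) the covariant derivative is with respect to the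
  FULL configuration `𝐔 = U′U` (bold letter), re-read on the render.

* T. Bałaban, *Propagators for lattice gauge theories in a background field*, Commun. Math. Phys. **99** (1985) 389–434
  [`Balaban1985BackgroundPropagators` = B9], p. 390 bottom, verbatim: *"(D^η_{U₀}A)(b) = η⁻¹(R(U₀(b))A(b₊) − A(b₋))"*,
  *"Let us recall that R(U)X = UXU⁻¹."* — the bond covariant derivative: for `b = ⟨x, x+ξe_μ⟩` and the direction `ν`,
  `(∇^ξ_{U,ν}A_μ)(x) = ξ⁻¹(U(x, x+ξe_ν) A_μ(x+ξe_ν) U(x, x+ξe_ν)⁻¹ − A_μ(x))` (`B8CurlGradHolonomy.covD`/`adT`, BY NAME).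

HONEST FRAMING (cell charter).  This module kernel-checks ONE elementary sentence of B12 §3 — condition (ii) in the
membership claim *"These restrictions can be easily obtained from the definition of the spaces"* for the product
configuration `exp iξ𝐀·𝐔` of (3.13) (GAPS G-adv9-2, item (ii), certified there BY HAND as «‖A′ + A‖ + BCH < α₁ needs
α₂ < ½α₁ − O(ξα₁²)»).  With `𝐔 = U′U`, `U′ = exp iξA′`, the product configuration is `(e^{iξ𝐀}e^{iξA′})·U`, so its
`U`-factor is unchanged and its `U′`-factor is `exp iξA″` with `A″ = (iξ)⁻¹log(e^{iξ𝐀}e^{iξA′})`; (ii) asks `|A″|, |∇^ξ_U A″| < α₁`.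
It is one-variable exponential/logarithm series estimates in a Banach algebra and real arithmetic.  It is NOT progress on the
series' theorems, NOT the continuum limit, NOT Clay; it discharges nothing of `B12Sec2to5` / `B12.lean`.  Condition (iii) is
`B12Membership314` (𝐔-half) and `B12CondIIIJ.jHalf_closes` (𝐉-half); (i) is inherited verbatim (the `U`-factor is unchanged
and `½α₀ξ² < α₀ξ²`); (iv) is NOT «from the definition» (G-adv9-2) and is not touched.

ABSOLUTE RULE.  No internally-minted statement enters as a cited fact: every theorem below is PROVED here from Mathlib and the
landed tree modules it imports (`Literature.Analysis.Complex.logOnePlus` / `hasSum_logOnePlus` / `exp_logOnePlus`,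
`Beta.TransportVertices.expTail` / `holonomy` / `norm_exp_mul_le`, `Beta.BackgroundVertices.expUnit`,
`B12Membership314.exp_units_conj'` / `units_conj_smul` / `norm_I_mul_smul` / `norm_eq_mul_norm_inv_smul` / `norm_mul_exp_le`,
`B8CurlGradHolonomy.covD` / `adT` — all BY NAME); the manuscripts are quoted only to say which printed display each statement is
the skeleton of.  Tags: `[folklore]` for the algebra/analysis, `[cite: Balaban1987RG1, …]` on the statements that transcribe a
printed claim — the cite tag documents WHAT IS TRANSCRIBED, the proof is ours.

WHAT THIS FILE PROVES (any complete normed ℂ-algebra `𝔸`; no commutativity, no `‖1‖ = 1`, no unitarity — the background bond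
variable `u = U(x, x+ξe_ν) ∈ 𝔸ˣ` carries NO norm hypothesis: only the conjugation `R(u)` enters, and the logarithm series is
conjugation-equivariant exactly).
* §1 Lipschitz toolkit [folklore]: `norm_pow_succ_sub_pow_succ_le'`, `norm_expTail_sub_expTail_le` (`‖tail_m e^x − tail_m e^y‖ ≤
  expTail m a·‖x − y‖` for `‖x‖, ‖y‖ ≤ a`; `m = 0`: `exp` is `e^a`-Lipschitz on the ball), `norm_expSubOneSub_sub_le`,
  `norm_exp_mul_exp_sub_one_le_of_le` (`‖e^Xe^Y − 1‖ ≤ e^{s} − 1` for `‖X‖+‖Y‖ ≤ s`, from `norm_holonomy_sub_one_le` BY NAME), `hasSum_logOnePlus_sub_self`,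
  `norm_logOnePlusSubSelf_sub_le` (`‖(log(1+w₁) − w₁) − (log(1+w₂) − w₂)‖ ≤ ρ/(1−ρ)·‖w₁ − w₂‖` for `‖wᵢ‖ ≤ ρ < 1`),
  `units_conj_logOnePlus` (`u log(1+w) u⁻¹ = log(1 + uwu⁻¹)`).
* §2 `bchLog X Y := logOnePlus (e^X e^Y − 1)` [folklore]: `exp_bchLog` (`e^{bchLog X Y} = e^X e^Y` for `‖e^Xe^Y − 1‖ < 1`, from
  `exp_logOnePlus` BY NAME), `units_conj_bchLog` (equivariance), and the BCH REMAINDER `G(X, Y) = bchLog X Y − (X + Y)`: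
  `norm_bchRem_le` (`‖G(X,Y)‖ ≤ 3(‖X‖+‖Y‖)²`) and the Lipschitz bound `norm_bchRem_sub_bchRem_le`
  (`‖G(X₁,Y₁) − G(X₂,Y₂)‖ ≤ 3(a+a′)(‖X₁−X₂‖ + ‖Y₁−Y₂‖)` for `‖Xᵢ‖ ≤ a`, `‖Yᵢ‖ ≤ a′`, `a + a′ ≤ 1/8`) — no commutator
  expansion is used: `G = (e^Xe^Y − 1 − X − Y) + (log(1+w) − w)` and both brackets are Lipschitz-small.
* §3 `newPot ξ A A′ := (iξ)⁻¹ • bchLog (iξ•A) (iξ•A′)` = `A″`: `exp_smul_newPot` (`e^{iξA″} = e^{iξA}e^{iξA′}`), `norm_newPot_le`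
  (`‖A″‖ ≤ ‖A‖ + ‖A′‖ + 3ξ(‖A‖+‖A′‖)²`), `units_conj_newPot` (`uA″₁u⁻¹ = newPot ξ (uA₁u⁻¹) (uA′₁u⁻¹)`), `conj_newPot_sub_newPot_eq`
  and `norm_covD_newPot_le` (`‖ξ⁻¹(uA″₁u⁻¹ − A″)‖ ≤ (1 + 3(a+a′))(‖ξ⁻¹(uA₁u⁻¹ − A)‖ + ‖ξ⁻¹(uA′₁u⁻¹ − A′)‖)`: the `U`-covariant
  derivative of `A″` is that of `A + A′` up to the Lipschitz constant of `G`), and `norm_sub_le_of_expUnit_conj` (`∇^ξ_𝐔` versus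
  `∇^ξ_U`: conjugating by `e^{iξA′_ν(x)}` costs `e^{2ξ|A′_ν|}(e^{2ξ|A′_ν|} − 1)`).
* §4 `budget313` (real arithmetic) and the TRANSCRIPTION `condII_expMul` [cite: Balaban1987RG1, p. 272 + (1.13) p. 262]: at a
  bond `b` and its `ν`-neighbour `b₁`, if `|A′(b)|, |A′(b₁)|, |A′_ν(x)|, |∇^ξ_{U,ν}A′(b)| < ½α₁` ((1.13) in `U^c_j(X, ½α₀, ½α₁, α₀)`),
  `|𝐀(b)|, |𝐀(b₁)|, |∇^ξ_{𝐔,ν}𝐀(b)| < α₂` ((3.14)), and `0 < ξ ≤ 1`, `8α₂ ≤ α₁ ≤ 1/16`, then `e^{iξA″} = e^{iξ𝐀}e^{iξA′}` at `b`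
  and `b₁`, `|A″(b)| < α₁` and `|∇^ξ_{U,ν}A″(b)| < α₁` — condition (ii) (1.13) for the `U′`-factor of `exp iξ𝐀·𝐔` in
  `U^c_j(X, ·, α₁, ·)`; lattice form `condII_covD_expMul` (`covD sν (adT Uν)`, full transporters `y ↦ expUnit ℂ (iξ•A′ν y)·Uν y`).

READING NOTES (recorded, nothing asserted).  (a) The clause «A′ has values in the algebra 𝔤ᶜ» of (1.13) is NOT transcribed:
that `A″ = (iξ)⁻¹log(e^{iξ𝐀}e^{iξA′})` is `𝔤ᶜ`-valued for `𝔤ᶜ`-valued `𝐀`, `A′` is the Lie-theoretic content of the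
Baker–Campbell–Hausdorff series (equivalently: `exp` restricted to a small ball of `𝔤ᶜ` is a chart of `Gᶜ` at `1`); this file
works in an arbitrary Banach algebra and records only the analytic half (representation, size, derivative).  (b) `|∇^ξ_U A′| < α₁`
and `|∇^ξ_𝐔𝐀| < α₂` are read COMPONENTWISE (each `(∇^ξ_{·,ν}·_μ)(b)`), hypotheses and conclusions alike; a Euclidean reading over
`ν` changes absolute constants only.  (c) (3.14) controls the derivative covariant w.r.t. the FULL `𝐔` (`𝐔(x, x+ξe_ν) =
e^{iξA′_ν(x)}U(x, x+ξe_ν)`), (1.13) the one w.r.t. `U`; since the letters are complex the conjugation by `e^{iξA′_ν}` is not an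
isometry and the comparison carries the dressing `e^{2ξ|A′_ν|}` (`norm_sub_le_of_expUnit_conj`), absorbed by the restriction.
(d) `8α₂ ≤ α₁ ≤ 1/16`, `ξ ≤ 1` is ONE admissible instance (the budget closes at ≈ `0.70·α₁` for `|A″|` and ≈ `0.83·α₁` for
`|∇^ξ_U A″|`); no optimality is claimed.  The restriction for (ii) depends on `α₁` — as in the hand certificate G-adv9-2 («α₂ ≤
c·min(α₀, α₁)») — while the print says «depending on α₀ and on some absolute constants»; whether the programme's standing
restrictions tie `α₁` to `α₀` is not adjudicated here (DIVERGENCE record).  (e) The norm is any submultiplicative complete algebra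
norm (operator or Hilbert–Schmidt reading of `|·|`, DIVERGENCE D-r1.1, both qualify).  (f) Mathlib's `exp_units_conj`, `exp_add`,
`exp_neg` ask `[NormedAlgebra ℚ 𝔸]`; over `ℂ` the file uses `B12Membership314.exp_units_conj'`, `Beta.BackgroundVertices.expUnit`
and `exp_add_of_commute_of_mem_ball` instead, and re-proves the `[NormOneClass]`-free Lipschitz lemmas of §1 (the tree's
`Literature.Analysis.Complex.norm_exp_sub_exp_le`, `B9Eq335Plaquette.norm_exp_sub_exp_le_of_le` carry `‖1‖ = 1`).

Version v1 (b2b-balaban-b12-g17, PAPER SUB-CELL B12 gen 17; journal claim B12-MEMBERSHIP-313-II).  GAPS record C-b12g17-1.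

REVISION v1.1 (docstrings only; every declaration byte-identical to v1): the docstring of `condII_expMul` closed the
quotation after «spaces» — v1's gloss (there mis-written `𝔄^𝔠_j`, `𝔄^𝔠`; meant: the spaces `U^c_j(X, α₀, α₁, γ₀)` of
p. 262) was ours, not print's (XREAD finding F1 LOW of b2b-balaban-pv05-g12, GAPS C-pv05g12-2).
-/

namespace Literature.MathematicalPhysics.QuantumFieldTheory.Balaban1983to89.B12Membership313II

open NormedSpace
open scoped Nat
open Literature.Analysis.Complex (logSeriesCoeff logOnePlus hasSum_logOnePlus logOnePlus_zero exp_logOnePlus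
  logSeriesCoeff_zero logSeriesCoeff_succ_mul norm_logSeriesCoeff_le)
open Literature.MathematicalPhysics.QuantumFieldTheory.Balaban1983to89
open Literature.MathematicalPhysics.QuantumFieldTheory.Balaban1983to89.Beta.TransportVertices
open Literature.MathematicalPhysics.QuantumFieldTheory.Balaban1983to89.B12Membership314
open Complex (I)

variable {𝔸 : Type*} [NormedRing 𝔸] [NormedAlgebra ℂ 𝔸] [CompleteSpace 𝔸]

/-! ## §1  Lipschitz toolkit in a complete normed ℂ-algebra (no `‖1‖ = 1`, no commutativity) -/

omit [NormedAlgebra ℂ 𝔸] [CompleteSpace 𝔸] in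
/-- `‖x^{n+1} − y^{n+1}‖ ≤ (n+1)·aⁿ·‖x − y‖` for `‖x‖, ‖y‖ ≤ a` (telescoping; cf. the tree's
`Literature.Analysis.Complex.norm_pow_succ_sub_pow_succ_le`, stated there under `[NormOneClass]`). [folklore] -/
theorem norm_pow_succ_sub_pow_succ_le' {x y : 𝔸} {a : ℝ} (hx : ‖x‖ ≤ a) (hy : ‖y‖ ≤ a) (n : ℕ) :
    ‖x ^ (n + 1) - y ^ (n + 1)‖ ≤ (n + 1) * a ^ n * ‖x - y‖ := by
  have ha : 0 ≤ a := (norm_nonneg x).trans hx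
  induction n with
  | zero => simp
  | succ n ih =>
    have hid : x ^ (n + 2) - y ^ (n + 2) = x * (x ^ (n + 1) - y ^ (n + 1)) + (x - y) * y ^ (n + 1) := by
      rw [mul_sub, sub_mul, pow_succ' x (n + 1), pow_succ' y (n + 1)]
      abel
    rw [hid]
    refine (norm_add_le _ _).trans ?_
    have h1 : ‖x * (x ^ (n + 1) - y ^ (n + 1))‖ ≤ a * ((n + 1) * a ^ n * ‖x - y‖) :=
      (norm_mul_le _ _).trans (mul_le_mul hx ih (norm_nonneg _) ha)
    have h2 : ‖(x - y) * y ^ (n + 1)‖ ≤ ‖x - y‖ * a ^ (n + 1) :=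
      (norm_mul_le _ _).trans (mul_le_mul_of_nonneg_left
        ((norm_pow_le' y (Nat.succ_pos n)).trans (pow_le_pow_left₀ (norm_nonneg _) hy _)) (norm_nonneg _))
    calc ‖x * (x ^ (n + 1) - y ^ (n + 1))‖ + ‖(x - y) * y ^ (n + 1)‖
        ≤ a * ((n + 1) * a ^ n * ‖x - y‖) + ‖x - y‖ * a ^ (n + 1) := add_le_add h1 h2
      _ = (↑(n + 1) + 1) * a ^ (n + 1) * ‖x - y‖ := by push_cast; ring

/-- **Lipschitz bound for the Taylor tails of `exp`**: for `‖x‖, ‖y‖ ≤ a`,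
`‖(e^x − Σ_{n≤m} xⁿ/n!) − (e^y − Σ_{n≤m} yⁿ/n!)‖ ≤ expTail m a · ‖x − y‖` (termwise, from `‖x^{k+1} − y^{k+1}‖ ≤ (k+1)aᵏ‖x − y‖`
and `Σ_{k≥m} aᵏ/k! = expTail m a` of `Beta.TransportVertices`). [folklore] -/
theorem norm_expTail_sub_expTail_le {x y : 𝔸} {a : ℝ} (hx : ‖x‖ ≤ a) (hy : ‖y‖ ≤ a) (m : ℕ) :
    ‖(exp x - ∑ n ∈ Finset.range (m + 1), (n !⁻¹ : ℂ) • x ^ n) -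
        (exp y - ∑ n ∈ Finset.range (m + 1), (n !⁻¹ : ℂ) • y ^ n)‖ ≤ expTail m a * ‖x - y‖ := by
  have h1 : ∀ z : 𝔸, HasSum (fun n => ((n + (m + 1))!⁻¹ : ℂ) • z ^ (n + (m + 1)))
      (exp z - ∑ n ∈ Finset.range (m + 1), (n !⁻¹ : ℂ) • z ^ n) := fun z =>
    (hasSum_nat_add_iff' (m + 1)).mpr (exp_series_hasSum_exp' (𝕂 := ℂ) z)
  have h2 := (h1 x).sub (h1 y)
  have hreal : HasSum (fun n : ℕ => a ^ (n + m) / (n + m)! * ‖x - y‖) (expTail m a * ‖x - y‖) :=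
    (hasSum_expTail m a).mul_right _
  refine h2.norm_le_of_bounded hreal fun n => ?_
  rw [← smul_sub, norm_smul, norm_inv, Complex.norm_natCast, show n + (m + 1) = (n + m) + 1 by ring]
  have hp := norm_pow_succ_sub_pow_succ_le' hx hy (n + m)
  have hfac : (((n + m) + 1)! : ℝ) = ((n + m : ℕ) + 1) * (n + m)! := by
    push_cast [Nat.factorial_succ]; ring
  have hf0 : (0 : ℝ) < (n + m)! := by positivity
  have hk0 : (0 : ℝ) < (n + m : ℕ) + 1 := by positivity
  calc (((n + m) + 1)! : ℝ)⁻¹ * ‖x ^ (n + m + 1) - y ^ (n + m + 1)‖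
      ≤ (((n + m) + 1)! : ℝ)⁻¹ * (((n + m : ℕ) + 1) * a ^ (n + m) * ‖x - y‖) :=
        mul_le_mul_of_nonneg_left (by exact_mod_cast hp) (by positivity)
    _ = a ^ (n + m) / (n + m)! * ‖x - y‖ := by
        rw [hfac]; field_simp

/-- `m = 1` (the case `m = 0`, `‖e^x − e^y‖ ≤ e^a‖x − y‖`, is used inline in `norm_bchRem_sub_bchRem_le`; cf. the tree's
`Literature.Analysis.Complex.norm_exp_sub_exp_le`, there with `[NormOneClass]`):
`‖(e^x − 1 − x) − (e^y − 1 − y)‖ ≤ (e^a − 1)‖x − y‖` for `‖x‖, ‖y‖ ≤ a`. [folklore] -/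
theorem norm_expSubOneSub_sub_le {x y : 𝔸} {a : ℝ} (hx : ‖x‖ ≤ a) (hy : ‖y‖ ≤ a) :
    ‖(exp x - 1 - x) - (exp y - 1 - y)‖ ≤ (Real.exp a - 1) * ‖x - y‖ := by
  have h := norm_expTail_sub_expTail_le hx hy 1
  simpa [Finset.sum_range_succ, sub_sub] using h

/-- `‖e^X e^Y − 1‖ ≤ e^{s} − 1` for `‖X‖ + ‖Y‖ ≤ s` (`Beta.TransportVertices.norm_holonomy_sub_one_le` for the list `[X, Y]`,
BY NAME; the hypothesis-free form `‖e^X e^Y − 1‖ ≤ e^{‖X‖+‖Y‖} − 1` is the tree's `B7Eq38Remainder.norm_exp_mul_exp_sub_one_le`,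
not imported here to keep the import cone of this leaf small). [folklore] -/
theorem norm_exp_mul_exp_sub_one_le_of_le {X Y : 𝔸} {s : ℝ} (h : ‖X‖ + ‖Y‖ ≤ s) :
    ‖exp X * exp Y - 1‖ ≤ Real.exp s - 1 := by
  have h1 : ‖exp X * exp Y - 1‖ ≤ Real.exp (‖X‖ + ‖Y‖) - 1 := by
    simpa [holonomy, size] using norm_holonomy_sub_one_le ℂ [X, Y]
  exact h1.trans (by gcongr)

/-! ### The logarithmic series: second-order tail, its Lipschitz bound, conjugation -/

/-- `‖logSeriesCoeff (n+1)‖·(n+1) = 1`. [folklore] -/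
theorem norm_logSeriesCoeff_succ_mul (n : ℕ) : ‖logSeriesCoeff (n + 1)‖ * (n + 1) = 1 := by
  have h := congrArg (‖·‖) (logSeriesCoeff_succ_mul n)
  simp only [norm_mul, norm_pow, norm_neg, norm_one, one_pow] at h
  have hc : ‖((n : ℂ) + 1)‖ = (n : ℝ) + 1 := by
    rw [show ((n : ℂ) + 1) = ((n + 1 : ℕ) : ℂ) by push_cast; ring, Complex.norm_natCast]; push_cast; ring
  rwa [hc] at h

/-- The logarithmic series from order two on: `Σ_{n≥2} c_n wⁿ = log(1+w) − w` for `‖w‖ < 1`. [folklore] -/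
theorem hasSum_logOnePlus_sub_self {w : 𝔸} (hw : ‖w‖ < 1) :
    HasSum (fun n : ℕ => logSeriesCoeff (n + 2) • w ^ (n + 2)) (logOnePlus w - w) := by
  have h := hasSum_logOnePlus hw
  rw [← hasSum_nat_add_iff' 2] at h
  have c1 : logSeriesCoeff 1 = 1 := by norm_num [logSeriesCoeff]
  have h2 : ∑ i ∈ Finset.range 2, logSeriesCoeff i • w ^ i = w := by
    rw [Finset.sum_range_succ, Finset.sum_range_succ, Finset.sum_range_zero, logSeriesCoeff_zero, c1,
      zero_smul, one_smul, pow_one, zero_add, zero_add]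
  rwa [h2] at h

/-- **Lipschitz bound for `w ↦ log(1+w) − w` on the ball `‖w‖ ≤ ρ < 1`**:
`‖(log(1+w₁) − w₁) − (log(1+w₂) − w₂)‖ ≤ ρ/(1−ρ)·‖w₁ − w₂‖` (termwise: `(1/n)·n ρ^{n−1}`, `n ≥ 2`). [folklore] -/
theorem norm_logOnePlusSubSelf_sub_le {w₁ w₂ : 𝔸} {ρ : ℝ} (h₁ : ‖w₁‖ ≤ ρ) (h₂ : ‖w₂‖ ≤ ρ) (hρ : ρ < 1) :
    ‖(logOnePlus w₁ - w₁) - (logOnePlus w₂ - w₂)‖ ≤ ρ / (1 - ρ) * ‖w₁ - w₂‖ := by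
  have hρ0 : 0 ≤ ρ := (norm_nonneg _).trans h₁
  have hs := (hasSum_logOnePlus_sub_self (h₁.trans_lt hρ)).sub (hasSum_logOnePlus_sub_self (h₂.trans_lt hρ))
  have hreal : HasSum (fun n : ℕ => ρ ^ (n + 1) * ‖w₁ - w₂‖) (ρ / (1 - ρ) * ‖w₁ - w₂‖) := by
    have hg := ((hasSum_geometric_of_lt_one hρ0 hρ).mul_left ρ).mul_right ‖w₁ - w₂‖
    simpa [pow_succ', div_eq_mul_inv] using hg
  refine hs.norm_le_of_bounded hreal fun n => ?_
  rw [← smul_sub]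
  have hc := norm_logSeriesCoeff_succ_mul (n + 1)
  calc ‖logSeriesCoeff (n + 2) • (w₁ ^ (n + 2) - w₂ ^ (n + 2))‖
      ≤ ‖logSeriesCoeff (n + 2)‖ * ‖w₁ ^ (n + 2) - w₂ ^ (n + 2)‖ := norm_smul_le _ _
    _ ≤ ‖logSeriesCoeff (n + 2)‖ * ((↑(n + 1) + 1) * ρ ^ (n + 1) * ‖w₁ - w₂‖) := by
        gcongr; exact norm_pow_succ_sub_pow_succ_le' h₁ h₂ (n + 1)
    _ = (‖logSeriesCoeff (n + 1 + 1)‖ * (↑(n + 1) + 1)) * (ρ ^ (n + 1) * ‖w₁ - w₂‖) := by ring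
    _ = ρ ^ (n + 1) * ‖w₁ - w₂‖ := by rw [hc, one_mul]

/-- **Conjugation commutes with the logarithmic series**: `u·log(1+w)·u⁻¹ = log(1 + u w u⁻¹)` for a unit `u` and `‖w‖ < 1`
(`(u w u⁻¹)ⁿ = u wⁿ u⁻¹`, continuity of left/right multiplication; no norm hypothesis on `u`). [folklore] -/
theorem units_conj_logOnePlus (u : 𝔸ˣ) {w : 𝔸} (hw : ‖w‖ < 1) :
    (u : 𝔸) * logOnePlus w * ↑u⁻¹ = logOnePlus ((u : 𝔸) * w * ↑u⁻¹) := by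
  have hs := ((hasSum_logOnePlus hw).mul_left (u : 𝔸)).mul_right (↑u⁻¹ : 𝔸)
  have hs' : HasSum (fun n : ℕ => logSeriesCoeff n • ((u : 𝔸) * w * ↑u⁻¹) ^ n)
      ((u : 𝔸) * logOnePlus w * ↑u⁻¹) := by
    refine hs.congr_fun fun n => ?_
    rw [Units.conj_pow, mul_smul_comm, smul_mul_assoc]
  exact hs'.tsum_eq.symm


/-! ## §2  The element `log(e^X e^Y)` near the identity and its BCH remainder -/

/-- `bchLog X Y = log(1 + (e^X e^Y − 1))`, the logarithmic series of `Literature.Analysis.Complex.LogOnePlus` at `e^X e^Y − 1`: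
for `‖e^X e^Y − 1‖ < 1` it is an element `Z` with `exp Z = e^X e^Y` (`exp_bchLog`).  [folklore] -/
noncomputable def bchLog (X Y : 𝔸) : 𝔸 := logOnePlus (exp X * exp Y - 1)

/-- `exp (bchLog X Y) = e^X e^Y` whenever `‖e^X e^Y − 1‖ < 1` (`exp_logOnePlus` BY NAME). [folklore] -/
theorem exp_bchLog {X Y : 𝔸} (h : ‖exp X * exp Y - 1‖ < 1) : exp (bchLog X Y) = exp X * exp Y := by
  rw [bchLog, exp_logOnePlus h, add_sub_cancel]

omit [CompleteSpace 𝔸] in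
/-- `bchLog 0 0 = 0`. [folklore] -/
@[simp] theorem bchLog_zero_zero : bchLog (0 : 𝔸) 0 = 0 := by
  simp [bchLog]

/-- **Conjugation equivariance**: `u·bchLog X Y·u⁻¹ = bchLog (uXu⁻¹) (uYu⁻¹)` for a unit `u` (no norm hypothesis on `u`), when
`‖e^X e^Y − 1‖ < 1` (B9 p. 390 «R(U)X = UXU⁻¹» commutes with `exp` and with the logarithmic series). [folklore] -/
theorem units_conj_bchLog (u : 𝔸ˣ) {X Y : 𝔸} (h : ‖exp X * exp Y - 1‖ < 1) :
    (u : 𝔸) * bchLog X Y * ↑u⁻¹ = bchLog ((u : 𝔸) * X * ↑u⁻¹) ((u : 𝔸) * Y * ↑u⁻¹) := by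
  rw [bchLog, bchLog, units_conj_logOnePlus u h, B12Membership314.exp_units_conj', B12Membership314.exp_units_conj']
  congr 1
  simp only [mul_sub, sub_mul, mul_one, Units.mul_inv, mul_assoc, Units.inv_mul_cancel_left]

omit [NormedAlgebra ℂ 𝔸] [CompleteSpace 𝔸] in
/-- Algebra: `e^X e^Y − 1 − X − Y = (e^X − 1 − X) + (e^Y − 1 − Y) + (e^X − 1)(e^Y − 1)`. [folklore] -/
theorem expMul_sub_one_sub_eq (X Y : 𝔸) :
    exp X * exp Y - 1 - (X + Y) = (exp X - 1 - X) + (exp Y - 1 - Y) + (exp X - 1) * (exp Y - 1) := by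
  noncomm_ring

omit [NormedAlgebra ℂ 𝔸] [CompleteSpace 𝔸] in
/-- Algebra: `a₁b₁ − a₂b₂ = (a₁ − a₂)b₁ + a₂(b₁ − b₂)`. [folklore] -/
theorem mul_sub_mul_eq (a₁ b₁ a₂ b₂ : 𝔸) : a₁ * b₁ - a₂ * b₂ = (a₁ - a₂) * b₁ + a₂ * (b₁ - b₂) := by
  noncomm_ring

/-- Real arithmetic of the Lipschitz constant: with `0 ≤ r ≤ 1/8` and `ρ = e^r − 1`:
`ρ/(1−ρ)·e^r + ρ ≤ 3r`. [folklore] -/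
theorem lipConst_le {r : ℝ} (hr0 : 0 ≤ r) (hr : r ≤ 1 / 8) :
    (Real.exp r - 1) / (1 - (Real.exp r - 1)) * Real.exp r + (Real.exp r - 1) ≤ 3 * r := by
  set ρ := Real.exp r - 1 with hρ
  have hρr : ρ ≤ r + r ^ 2 := by
    have h := Real.abs_exp_sub_one_sub_id_le (x := r) (by rw [abs_of_nonneg hr0]; linarith)
    have := (abs_le.mp h).2
    rw [hρ]; linarith
  have hρ0 : 0 ≤ ρ := by rw [hρ]; linarith [Real.add_one_le_exp r]
  have hρ1 : ρ ≤ 9 / 64 := by nlinarith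
  have hden : 55 / 64 ≤ 1 - ρ := by linarith
  have hE : Real.exp r = 1 + ρ := by rw [hρ]; ring
  have h1 : ρ / (1 - ρ) ≤ 64 / 55 * ρ := by
    rw [div_le_iff₀ (by linarith)]
    nlinarith
  rw [hE]
  nlinarith [mul_le_mul_of_nonneg_right h1 (by linarith : (0:ℝ) ≤ 1 + ρ)]

/-- **Lipschitz bound for the BCH remainder `G(X, Y) = bchLog X Y − (X + Y)`**: if `‖X₁‖, ‖X₂‖ ≤ a`, `‖Y₁‖, ‖Y₂‖ ≤ a'` and
`a + a' ≤ 1/8`, then `‖G(X₁,Y₁) − G(X₂,Y₂)‖ ≤ 3(a + a')(‖X₁ − X₂‖ + ‖Y₁ − Y₂‖)`.  Pieces: `w = e^Xe^Y − 1` is `e^{a+a'}`-Lipschitz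
and has norm `≤ ρ = e^{a+a'} − 1`; `log(1+w) − w` is `ρ/(1−ρ)`-Lipschitz on that ball; `w − X − Y` is `(e^{a+a'} − 1)`-Lipschitz by
`expMul_sub_one_sub_eq`; `lipConst_le`.  No commutativity, no `‖1‖ = 1`. [folklore] -/
theorem norm_bchRem_sub_bchRem_le {X₁ Y₁ X₂ Y₂ : 𝔸} {a a' : ℝ} (hX₁ : ‖X₁‖ ≤ a) (hX₂ : ‖X₂‖ ≤ a)
    (hY₁ : ‖Y₁‖ ≤ a') (hY₂ : ‖Y₂‖ ≤ a') (hr : a + a' ≤ 1 / 8) :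
    ‖(bchLog X₁ Y₁ - (X₁ + Y₁)) - (bchLog X₂ Y₂ - (X₂ + Y₂))‖ ≤
      3 * (a + a') * (‖X₁ - X₂‖ + ‖Y₁ - Y₂‖) := by
  have ha : 0 ≤ a := (norm_nonneg _).trans hX₁
  have ha' : 0 ≤ a' := (norm_nonneg _).trans hY₁
  set r := a + a' with hr_def
  set ρ := Real.exp r - 1 with hρ
  set δ := ‖X₁ - X₂‖ + ‖Y₁ - Y₂‖ with hδ
  have hδ0 : 0 ≤ δ := by positivity
  have hρ0 : 0 ≤ ρ := by rw [hρ]; linarith [Real.add_one_le_exp r]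
  have hρr : ρ ≤ r + r ^ 2 := by
    have h := Real.abs_exp_sub_one_sub_id_le (x := r) (by rw [abs_of_nonneg (by positivity)]; linarith)
    have := (abs_le.mp h).2
    rw [hρ]; linarith
  have hρ1 : ρ < 1 := by nlinarith
  -- the letters `w_i = e^{X_i}e^{Y_i} − 1`
  set w₁ := exp X₁ * exp Y₁ - 1 with hw₁
  set w₂ := exp X₂ * exp Y₂ - 1 with hw₂
  have hw₁ρ : ‖w₁‖ ≤ ρ := norm_exp_mul_exp_sub_one_le_of_le (add_le_add hX₁ hY₁)
  have hw₂ρ : ‖w₂‖ ≤ ρ := norm_exp_mul_exp_sub_one_le_of_le (add_le_add hX₂ hY₂)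
  -- exponential sizes
  have eX : ‖exp X₁ - exp X₂‖ ≤ Real.exp a * ‖X₁ - X₂‖ := by
    simpa [expTail] using norm_expTail_sub_expTail_le hX₁ hX₂ 0
  have eY : ‖exp Y₁ - exp Y₂‖ ≤ Real.exp a' * ‖Y₁ - Y₂‖ := by
    simpa [expTail] using norm_expTail_sub_expTail_le hY₁ hY₂ 0
  have eX1 : ‖exp X₂ - 1‖ ≤ Real.exp a - 1 :=
    (by simpa using norm_exp_sub_one_le_expTail ℂ X₂ : ‖exp X₂ - 1‖ ≤ Real.exp ‖X₂‖ - 1).trans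
      (by gcongr)
  have eY1 : ‖exp Y₁ - 1‖ ≤ Real.exp a' - 1 :=
    (by simpa using norm_exp_sub_one_le_expTail ℂ Y₁ : ‖exp Y₁ - 1‖ ≤ Real.exp ‖Y₁‖ - 1).trans
      (by gcongr)
  have hea : 1 ≤ Real.exp a := Real.one_le_exp ha
  have hea' : 1 ≤ Real.exp a' := Real.one_le_exp ha'
  have hEr : Real.exp r = Real.exp a * Real.exp a' := by rw [hr_def, Real.exp_add]
  -- (1) `w` is `e^r`-Lipschitz
  have hw : ‖w₁ - w₂‖ ≤ Real.exp r * δ := by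
    have hsplit : w₁ - w₂ = (exp X₁ - exp X₂) * exp Y₁ + exp X₂ * (exp Y₁ - exp Y₂) := by
      rw [hw₁, hw₂]; noncomm_ring
    rw [hsplit]
    have t1 : ‖(exp X₁ - exp X₂) * exp Y₁‖ ≤ Real.exp a * ‖X₁ - X₂‖ * Real.exp a' :=
      (norm_mul_exp_le _ _).trans (mul_le_mul eX (Real.exp_le_exp.mpr hY₁) (Real.exp_pos _).le (by positivity))
    have t2 : ‖exp X₂ * (exp Y₁ - exp Y₂)‖ ≤ Real.exp a * (Real.exp a' * ‖Y₁ - Y₂‖) :=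
      (norm_exp_mul_le ℂ _ _).trans (mul_le_mul (Real.exp_le_exp.mpr hX₂) eY (norm_nonneg _) (Real.exp_pos _).le)
    calc ‖(exp X₁ - exp X₂) * exp Y₁ + exp X₂ * (exp Y₁ - exp Y₂)‖
        ≤ Real.exp a * ‖X₁ - X₂‖ * Real.exp a' + Real.exp a * (Real.exp a' * ‖Y₁ - Y₂‖) := norm_add_le_of_le t1 t2
      _ = Real.exp r * δ := by rw [hEr, hδ]; ring
  -- (2) the log tail is `ρ/(1−ρ)`-Lipschitz on the ball
  have hlog : ‖(logOnePlus w₁ - w₁) - (logOnePlus w₂ - w₂)‖ ≤ ρ / (1 - ρ) * (Real.exp r * δ) :=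
    (norm_logOnePlusSubSelf_sub_le hw₁ρ hw₂ρ hρ1).trans
      (mul_le_mul_of_nonneg_left hw (div_nonneg hρ0 (by linarith)))
  -- (3) `w − X − Y` is `(e^r − 1)`-Lipschitz
  have hq : ‖(w₁ - (X₁ + Y₁)) - (w₂ - (X₂ + Y₂))‖ ≤ ρ * δ := by
    have hsplit : (w₁ - (X₁ + Y₁)) - (w₂ - (X₂ + Y₂)) =
        ((exp X₁ - 1 - X₁) - (exp X₂ - 1 - X₂)) + ((exp Y₁ - 1 - Y₁) - (exp Y₂ - 1 - Y₂)) +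
          ((exp X₁ - exp X₂) * (exp Y₁ - 1) + (exp X₂ - 1) * (exp Y₁ - exp Y₂)) := by
      rw [hw₁, hw₂]; noncomm_ring
    rw [hsplit]
    have t1 := norm_expSubOneSub_sub_le hX₁ hX₂
    have t2 := norm_expSubOneSub_sub_le hY₁ hY₂
    have t3 : ‖(exp X₁ - exp X₂) * (exp Y₁ - 1)‖ ≤ Real.exp a * ‖X₁ - X₂‖ * (Real.exp a' - 1) :=
      (norm_mul_le _ _).trans (mul_le_mul eX eY1 (norm_nonneg _) (by positivity))
    have t4 : ‖(exp X₂ - 1) * (exp Y₁ - exp Y₂)‖ ≤ (Real.exp a - 1) * (Real.exp a' * ‖Y₁ - Y₂‖) :=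
      (norm_mul_le _ _).trans (mul_le_mul eX1 eY (norm_nonneg _) (by linarith))
    calc ‖((exp X₁ - 1 - X₁) - (exp X₂ - 1 - X₂)) + ((exp Y₁ - 1 - Y₁) - (exp Y₂ - 1 - Y₂)) +
          ((exp X₁ - exp X₂) * (exp Y₁ - 1) + (exp X₂ - 1) * (exp Y₁ - exp Y₂))‖
        ≤ (Real.exp a - 1) * ‖X₁ - X₂‖ + (Real.exp a' - 1) * ‖Y₁ - Y₂‖ +
            (Real.exp a * ‖X₁ - X₂‖ * (Real.exp a' - 1) + (Real.exp a - 1) * (Real.exp a' * ‖Y₁ - Y₂‖)) :=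
          norm_add_le_of_le (norm_add_le_of_le t1 t2) (norm_add_le_of_le t3 t4)
      _ = ρ * δ := by rw [hρ, hEr, hδ]; ring
  -- assemble
  have hsplit : (bchLog X₁ Y₁ - (X₁ + Y₁)) - (bchLog X₂ Y₂ - (X₂ + Y₂)) =
      ((logOnePlus w₁ - w₁) - (logOnePlus w₂ - w₂)) + ((w₁ - (X₁ + Y₁)) - (w₂ - (X₂ + Y₂))) := by
    simp only [bchLog, ← hw₁, ← hw₂]; abel
  rw [hsplit]
  refine (norm_add_le_of_le hlog hq).trans ?_
  have hK := lipConst_le (by positivity : 0 ≤ r) hr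
  have hEρ : Real.exp r = 1 + ρ := by rw [hρ]; ring
  calc ρ / (1 - ρ) * (Real.exp r * δ) + ρ * δ = (ρ / (1 - ρ) * Real.exp r + ρ) * δ := by ring
    _ ≤ 3 * r * δ := mul_le_mul_of_nonneg_right hK hδ0
    _ = 3 * (a + a') * (‖X₁ - X₂‖ + ‖Y₁ - Y₂‖) := by rw [hr_def, hδ]

/-- ZEROTH ORDER, as the case `X₂ = Y₂ = 0`: `‖bchLog X Y − (X + Y)‖ ≤ 3(‖X‖ + ‖Y‖)²` for `‖X‖ + ‖Y‖ ≤ 1/8`. [folklore] -/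
theorem norm_bchRem_le {X Y : 𝔸} (h : ‖X‖ + ‖Y‖ ≤ 1 / 8) :
    ‖bchLog X Y - (X + Y)‖ ≤ 3 * (‖X‖ + ‖Y‖) ^ 2 := by
  have h0 := norm_bchRem_sub_bchRem_le (X₂ := 0) (Y₂ := 0) le_rfl (by simp) le_rfl (by simp) h
  simpa [sq, mul_assoc] using h0


/-! ## §3  The new `U′`-potential `A″ = (iξ)⁻¹ log(e^{iξA} e^{iξA′})` at one bond: representation, size, covariant derivative -/

/-- The potential of the new `U′`-factor of the product configuration: with `𝐔 = U′U`, `U′ = exp iξA′` and the fluctuation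
factor `exp iξA` on the left, `exp iξ𝐀·𝐔 = e^{iξA} e^{iξA′} U = exp(iξA″)·U` where
`A″ = newPot ξ A A′ := (iξ)⁻¹·log(e^{iξA} e^{iξA′})` (`exp_smul_newPot`). [folklore] -/
noncomputable def newPot (ξ : ℝ) (A A' : 𝔸) : 𝔸 := (I * ξ)⁻¹ • bchLog ((I * ξ) • A) ((I * ξ) • A')

/-- `iξ ≠ 0` for `ξ ≠ 0`. [folklore] -/
theorem I_mul_ne_zero {ξ : ℝ} (hξ : ξ ≠ 0) : (I * ξ : ℂ) ≠ 0 :=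
  mul_ne_zero Complex.I_ne_zero (Complex.ofReal_ne_zero.mpr hξ)

omit [NormedAlgebra ℂ 𝔸] [CompleteSpace 𝔸] in
/-- `‖(iξ)⁻¹ • Z‖ = ξ⁻¹‖Z‖` for `ξ > 0`. [folklore] -/
theorem norm_I_mul_inv_smul {𝔹 : Type*} [SeminormedAddCommGroup 𝔹] [NormedSpace ℂ 𝔹] {ξ : ℝ} (hξ : 0 < ξ) (Z : 𝔹) :
    ‖(I * ξ : ℂ)⁻¹ • Z‖ = ξ⁻¹ * ‖Z‖ := by
  rw [norm_smul, norm_inv, Complex.norm_mul, Complex.norm_I, one_mul, Complex.norm_real, Real.norm_eq_abs,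
    abs_of_pos hξ]

/-- Smallness of `e^X e^Y − 1`: `‖X‖ + ‖Y‖ ≤ 1/4 ⟹ ‖e^X e^Y − 1‖ < 1` (`e^s − 1 ≤ 2s`). [folklore] -/
theorem norm_expMul_sub_one_lt_one {X Y : 𝔸} (h : ‖X‖ + ‖Y‖ ≤ 1 / 4) : ‖exp X * exp Y - 1‖ < 1 := by
  refine (norm_exp_mul_exp_sub_one_le_of_le h).trans_lt ?_
  have h1 := Real.abs_exp_sub_one_le (x := 1 / 4) (by rw [abs_of_nonneg (by norm_num)]; norm_num)
  rw [abs_of_nonneg (by norm_num : (0 : ℝ) ≤ 1 / 4)] at h1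
  linarith [le_abs_self (Real.exp (1 / 4 : ℝ) - 1)]

/-- **Representation**: `exp (iξ·newPot ξ A A′) = e^{iξA} e^{iξA′}` (`ξ ≠ 0`, `‖e^{iξA}e^{iξA′} − 1‖ < 1`). [folklore] -/
theorem exp_smul_newPot {ξ : ℝ} (hξ : ξ ≠ 0) {A A' : 𝔸}
    (hw : ‖exp ((I * ξ) • A) * exp ((I * ξ) • A') - 1‖ < 1) :
    exp ((I * ξ) • newPot ξ A A') = exp ((I * ξ) • A) * exp ((I * ξ) • A') := by
  rw [newPot, smul_smul, mul_inv_cancel₀ (I_mul_ne_zero hξ), one_smul, exp_bchLog hw]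

omit [CompleteSpace 𝔸] in
/-- `newPot ξ A A′ − (A + A′) = (iξ)⁻¹·G(iξA, iξA′)` with the BCH remainder `G(X, Y) = bchLog X Y − (X + Y)`. [folklore] -/
theorem newPot_sub_add {ξ : ℝ} (hξ : ξ ≠ 0) (A A' : 𝔸) :
    newPot ξ A A' - (A + A') =
      (I * ξ)⁻¹ • (bchLog ((I * ξ) • A) ((I * ξ) • A') - ((I * ξ) • A + (I * ξ) • A')) := by
  rw [smul_sub, ← smul_add, smul_smul, inv_mul_cancel₀ (I_mul_ne_zero hξ), one_smul, newPot]

/-- **Size**: `‖newPot ξ A A′‖ ≤ ‖A‖ + ‖A′‖ + 3ξ(‖A‖ + ‖A′‖)²` when `ξ(‖A‖ + ‖A′‖) ≤ 1/8` — the hand certificate's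
«‖A′ + A‖ + BCH» with the BCH term `O(ξ(‖A‖ + ‖A′‖)²)` made explicit. [folklore] -/
theorem norm_newPot_le {ξ : ℝ} (hξ : 0 < ξ) {A A' : 𝔸} (h : ξ * (‖A‖ + ‖A'‖) ≤ 1 / 8) :
    ‖newPot ξ A A'‖ ≤ ‖A‖ + ‖A'‖ + 3 * ξ * (‖A‖ + ‖A'‖) ^ 2 := by
  have hX : ‖(I * ξ) • A‖ + ‖(I * ξ) • A'‖ ≤ 1 / 8 := by
    rw [norm_I_mul_smul hξ.le, norm_I_mul_smul hξ.le]; linarith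
  have hG := norm_bchRem_le hX
  rw [norm_I_mul_smul hξ.le, norm_I_mul_smul hξ.le] at hG
  set G := bchLog ((I * ξ) • A) ((I * ξ) • A') - ((I * ξ) • A + (I * ξ) • A') with hGdef
  have h1 : ‖newPot ξ A A' - (A + A')‖ ≤ 3 * ξ * (‖A‖ + ‖A'‖) ^ 2 := by
    rw [newPot_sub_add hξ.ne', ← hGdef, norm_I_mul_inv_smul hξ]
    calc ξ⁻¹ * ‖G‖ ≤ ξ⁻¹ * (3 * (ξ * ‖A‖ + ξ * ‖A'‖) ^ 2) := by gcongr
      _ = 3 * ξ * (‖A‖ + ‖A'‖) ^ 2 := by field_simp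
  calc ‖newPot ξ A A'‖ ≤ ‖A + A'‖ + ‖newPot ξ A A' - (A + A')‖ := norm_le_norm_add_norm_sub' _ _
    _ ≤ ‖A‖ + ‖A'‖ + 3 * ξ * (‖A‖ + ‖A'‖) ^ 2 := add_le_add (norm_add_le _ _) h1

/-- **Transport**: `u·newPot ξ A₁ A′₁·u⁻¹ = newPot ξ (uA₁u⁻¹) (uA′₁u⁻¹)` for a unit `u` (the background bond variable; no norm
hypothesis), when `‖e^{iξA₁}e^{iξA′₁} − 1‖ < 1`. [folklore] -/
theorem units_conj_newPot (u : 𝔸ˣ) (ξ : ℝ) {A₁ A'₁ : 𝔸}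
    (hw : ‖exp ((I * ξ) • A₁) * exp ((I * ξ) • A'₁) - 1‖ < 1) :
    (u : 𝔸) * newPot ξ A₁ A'₁ * ↑u⁻¹ = newPot ξ ((u : 𝔸) * A₁ * ↑u⁻¹) ((u : 𝔸) * A'₁ * ↑u⁻¹) := by
  rw [newPot, newPot, units_conj_smul, units_conj_bchLog u hw, units_conj_smul, units_conj_smul]

/-- **The covariant difference of the new potential**: with `Ã₁ = uA₁u⁻¹`, `Ã′₁ = uA′₁u⁻¹`,
`u·A″₁·u⁻¹ − A″ = (Ã₁ − A) + (Ã′₁ − A′) + (iξ)⁻¹·(G(iξÃ₁, iξÃ′₁) − G(iξA, iξA′))`. [folklore] -/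
theorem conj_newPot_sub_newPot_eq (u : 𝔸ˣ) {ξ : ℝ} (hξ : ξ ≠ 0) {A A' A₁ A'₁ : 𝔸}
    (hw : ‖exp ((I * ξ) • A₁) * exp ((I * ξ) • A'₁) - 1‖ < 1) :
    (u : 𝔸) * newPot ξ A₁ A'₁ * ↑u⁻¹ - newPot ξ A A' =
      ((u : 𝔸) * A₁ * ↑u⁻¹ - A) + ((u : 𝔸) * A'₁ * ↑u⁻¹ - A') +
        (I * ξ)⁻¹ • ((bchLog ((I * ξ) • ((u : 𝔸) * A₁ * ↑u⁻¹)) ((I * ξ) • ((u : 𝔸) * A'₁ * ↑u⁻¹)) -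
              ((I * ξ) • ((u : 𝔸) * A₁ * ↑u⁻¹) + (I * ξ) • ((u : 𝔸) * A'₁ * ↑u⁻¹))) -
            (bchLog ((I * ξ) • A) ((I * ξ) • A') - ((I * ξ) • A + (I * ξ) • A'))) := by
  rw [units_conj_newPot u ξ hw, smul_sub, ← newPot_sub_add hξ, ← newPot_sub_add hξ]
  abel

/-- **First-order bound**: if `ξ‖A‖, ξ‖uA₁u⁻¹‖ ≤ a`, `ξ‖A′‖, ξ‖uA′₁u⁻¹‖ ≤ a′`, `a + a′ ≤ 1/8`, then
`‖ξ⁻¹(u·A″₁·u⁻¹ − A″)‖ ≤ (1 + 3(a + a′))·(‖ξ⁻¹(uA₁u⁻¹ − A)‖ + ‖ξ⁻¹(uA′₁u⁻¹ − A′)‖)` — the `U`-covariant derivative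
of `A″` is that of `A + A′` up to the Lipschitz constant of the BCH remainder (`norm_bchRem_sub_bchRem_le`). [folklore] -/
theorem norm_covD_newPot_le (u : 𝔸ˣ) {ξ a a' : ℝ} (hξ : 0 < ξ) {A A' A₁ A'₁ : 𝔸}
    (hw : ‖exp ((I * ξ) • A₁) * exp ((I * ξ) • A'₁) - 1‖ < 1)
    (h₁ : ξ * ‖A‖ ≤ a) (h₂ : ξ * ‖(u : 𝔸) * A₁ * ↑u⁻¹‖ ≤ a) (h₃ : ξ * ‖A'‖ ≤ a')
    (h₄ : ξ * ‖(u : 𝔸) * A'₁ * ↑u⁻¹‖ ≤ a') (hr : a + a' ≤ 1 / 8) :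
    ‖(ξ : ℂ)⁻¹ • ((u : 𝔸) * newPot ξ A₁ A'₁ * ↑u⁻¹ - newPot ξ A A')‖ ≤
      (1 + 3 * (a + a')) *
        (‖(ξ : ℂ)⁻¹ • ((u : 𝔸) * A₁ * ↑u⁻¹ - A)‖ + ‖(ξ : ℂ)⁻¹ • ((u : 𝔸) * A'₁ * ↑u⁻¹ - A')‖) := by
  have ha : 0 ≤ a := le_trans (by positivity) h₁
  have ha' : 0 ≤ a' := le_trans (by positivity) h₃
  rw [conj_newPot_sub_newPot_eq u hξ.ne' hw]
  set At := (u : 𝔸) * A₁ * ↑u⁻¹ with hAt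
  set At' := (u : 𝔸) * A'₁ * ↑u⁻¹ with hAt'
  set D₁ := At - A with hD₁
  set D₂ := At' - A' with hD₂
  set ΔG := (bchLog ((I * ξ) • At) ((I * ξ) • At') - ((I * ξ) • At + (I * ξ) • At')) -
      (bchLog ((I * ξ) • A) ((I * ξ) • A') - ((I * ξ) • A + (I * ξ) • A')) with hΔG
  have hG : ‖ΔG‖ ≤ 3 * (a + a') * (‖(I * ξ) • At - (I * ξ) • A‖ + ‖(I * ξ) • At' - (I * ξ) • A'‖) :=
    norm_bchRem_sub_bchRem_le (by rwa [norm_I_mul_smul hξ.le]) (by rwa [norm_I_mul_smul hξ.le])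
      (by rwa [norm_I_mul_smul hξ.le]) (by rwa [norm_I_mul_smul hξ.le]) hr
  rw [← smul_sub, ← smul_sub, norm_I_mul_smul hξ.le, norm_I_mul_smul hξ.le, ← hD₁, ← hD₂] at hG
  have e1 : ‖D₁‖ = ξ * ‖(ξ : ℂ)⁻¹ • D₁‖ := norm_eq_mul_norm_inv_smul hξ D₁
  have e2 : ‖D₂‖ = ξ * ‖(ξ : ℂ)⁻¹ • D₂‖ := norm_eq_mul_norm_inv_smul hξ D₂
  set d₁ := ‖(ξ : ℂ)⁻¹ • D₁‖
  set d₂ := ‖(ξ : ℂ)⁻¹ • D₂‖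
  rw [e1, e2] at hG
  have hT : ‖(ξ : ℂ)⁻¹ • ((I * ξ)⁻¹ • ΔG)‖ ≤ 3 * (a + a') * (d₁ + d₂) := by
    rw [norm_smul, norm_I_mul_inv_smul hξ, norm_inv, Complex.norm_real, Real.norm_eq_abs, abs_of_pos hξ]
    calc ξ⁻¹ * (ξ⁻¹ * ‖ΔG‖) ≤ ξ⁻¹ * (ξ⁻¹ * (3 * (a + a') * (ξ * (ξ * d₁) + ξ * (ξ * d₂)))) := by gcongr
      _ = 3 * (a + a') * (d₁ + d₂) := by field_simp
  rw [smul_add, smul_add]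
  calc ‖(ξ : ℂ)⁻¹ • D₁ + (ξ : ℂ)⁻¹ • D₂ + (ξ : ℂ)⁻¹ • ((I * ξ)⁻¹ • ΔG)‖
      ≤ ‖(ξ : ℂ)⁻¹ • D₁‖ + ‖(ξ : ℂ)⁻¹ • D₂‖ + ‖(ξ : ℂ)⁻¹ • ((I * ξ)⁻¹ • ΔG)‖ := norm_add₃_le
    _ ≤ d₁ + d₂ + 3 * (a + a') * (d₁ + d₂) := by gcongr
    _ = (1 + 3 * (a + a')) * (d₁ + d₂) := by ring

/-- **`∇^ξ_𝐔` versus `∇^ξ_U`** (B12 (3.14) is stated with the FULL transporter `𝐔(b) = U′(b)U(b) = e^{Y}·U(b)`, `Y = iξA′_ν(x)`,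
while (1.13) uses the `G`-valued factor `U(b)`): for the unit `E = expUnit ℂ Y` (values `e^{Y}`, `e^{−Y}`) and any `Ã`, `A`,
`‖Ã − A‖ ≤ ‖EÃE⁻¹ − A‖ + e^{2‖Y‖}(e^{2‖Y‖} − 1)(‖A‖ + ‖EÃE⁻¹ − A‖)`  (`Ã = E⁻¹(EÃE⁻¹)E`, `EÃE⁻¹ − Ã = (e^Y − 1)Ãe^{−Y} + Ã(e^{−Y} − 1)`;
no `‖1‖ = 1`). [folklore] -/
theorem norm_sub_le_of_expUnit_conj (Y At A : 𝔸) :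
    ‖At - A‖ ≤ ‖(Beta.BackgroundVertices.expUnit ℂ Y : 𝔸) * At * ↑(Beta.BackgroundVertices.expUnit ℂ Y)⁻¹ - A‖ +
      Real.exp (2 * ‖Y‖) * (Real.exp (2 * ‖Y‖) - 1) *
        (‖A‖ + ‖(Beta.BackgroundVertices.expUnit ℂ Y : 𝔸) * At * ↑(Beta.BackgroundVertices.expUnit ℂ Y)⁻¹ - A‖) := by
  set E := Beta.BackgroundVertices.expUnit ℂ Y with hE
  set T := (E : 𝔸) * At * ↑E⁻¹ with hT
  have hEv : (E : 𝔸) = exp Y := rfl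
  have hEi : (↑E⁻¹ : 𝔸) = exp (-Y) := rfl
  have hAt : At = (↑E⁻¹ : 𝔸) * T * ↑E := by
    rw [hT]; simp only [mul_assoc, Units.inv_mul_cancel_left, Units.inv_mul, mul_one]
  set y := ‖Y‖ with hy
  have hy0 : 0 ≤ y := norm_nonneg _
  have he1 : ‖exp Y - 1‖ ≤ Real.exp y - 1 := by simpa using norm_exp_sub_one_le_expTail ℂ Y
  have he2 : ‖exp (-Y) - 1‖ ≤ Real.exp y - 1 := by simpa [norm_neg] using norm_exp_sub_one_le_expTail ℂ (-Y)
  have hey : 1 ≤ Real.exp y := Real.one_le_exp hy0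
  have h2y : Real.exp (2 * y) = Real.exp y * Real.exp y := by rw [two_mul, Real.exp_add]
  -- `‖Ã‖ ≤ e^{2y}‖T‖`
  have n1 : ‖At‖ ≤ Real.exp (2 * y) * ‖T‖ := by
    rw [hAt, hEi, hEv]
    calc ‖exp (-Y) * T * exp Y‖ ≤ ‖exp (-Y) * T‖ * Real.exp ‖Y‖ := norm_mul_exp_le _ _
      _ ≤ (Real.exp ‖-Y‖ * ‖T‖) * Real.exp ‖Y‖ :=
          mul_le_mul_of_nonneg_right (norm_exp_mul_le ℂ _ _) (Real.exp_pos _).le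
      _ = Real.exp (2 * y) * ‖T‖ := by rw [norm_neg, ← hy, h2y]; ring
  -- `‖T − Ã‖ ≤ ‖Ã‖(e^{2y} − 1)`
  have n2 : ‖T - At‖ ≤ ‖At‖ * (Real.exp (2 * y) - 1) := by
    have hsplit : T - At = (exp Y - 1) * At * exp (-Y) + At * (exp (-Y) - 1) := by
      rw [hT, hEv, hEi]; noncomm_ring
    rw [hsplit]
    have t1 : ‖(exp Y - 1) * At * exp (-Y)‖ ≤ (Real.exp y - 1) * ‖At‖ * Real.exp y := by
      calc ‖(exp Y - 1) * At * exp (-Y)‖ ≤ ‖(exp Y - 1) * At‖ * Real.exp ‖-Y‖ := norm_mul_exp_le _ _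
        _ ≤ ((Real.exp y - 1) * ‖At‖) * Real.exp y := by
            rw [norm_neg, ← hy]
            exact mul_le_mul_of_nonneg_right ((norm_mul_le _ _).trans
              (mul_le_mul_of_nonneg_right he1 (norm_nonneg _))) (Real.exp_pos _).le
    have t2 : ‖At * (exp (-Y) - 1)‖ ≤ ‖At‖ * (Real.exp y - 1) :=
      (norm_mul_le _ _).trans (mul_le_mul_of_nonneg_left he2 (norm_nonneg _))
    calc ‖(exp Y - 1) * At * exp (-Y) + At * (exp (-Y) - 1)‖
        ≤ (Real.exp y - 1) * ‖At‖ * Real.exp y + ‖At‖ * (Real.exp y - 1) := norm_add_le_of_le t1 t2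
      _ = ‖At‖ * (Real.exp (2 * y) - 1) := by rw [h2y]; ring
  have n3 : ‖T‖ ≤ ‖A‖ + ‖T - A‖ := norm_le_norm_add_norm_sub' T A
  have hκ0 : 0 ≤ Real.exp (2 * y) - 1 := by nlinarith
  calc ‖At - A‖ = ‖(T - A) - (T - At)‖ := by congr 1; abel
    _ ≤ ‖T - A‖ + ‖T - At‖ := norm_sub_le _ _
    _ ≤ ‖T - A‖ + (Real.exp (2 * y) * ‖T‖) * (Real.exp (2 * y) - 1) :=
        add_le_add le_rfl (n2.trans (mul_le_mul_of_nonneg_right n1 hκ0))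
    _ ≤ ‖T - A‖ + (Real.exp (2 * y) * (‖A‖ + ‖T - A‖)) * (Real.exp (2 * y) - 1) := by
        gcongr
    _ = ‖T - A‖ + Real.exp (2 * y) * (Real.exp (2 * y) - 1) * (‖A‖ + ‖T - A‖) := by ring


/-! ## §4  B12 p. 272 → condition (ii) of (1.13) for the product configuration `exp iξ𝐀·𝐔` — the transcription -/

/-- [folklore] **The real-arithmetic budget of `condII_expMul`** (small-context lemma; all the `nlinarith` lives here).
Letters: `nA = |𝐀(b)|`, `nA′ = |A′(b)|`, `nB′ = |A′_ν(x)|`, `dB = |∇^ξ_{𝐔,ν}𝐀(b)|` (bold), `d₁ = |∇^ξ_{U,ν}𝐀(b)|` (plain),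
`d₂ = |∇^ξ_{U,ν}A′(b)|`, `nAt = |u𝐀(b₁)u⁻¹|`, `nAt′ = |uA′(b₁)u⁻¹|`, `κ = e^{2ξ nB′} − 1`; `hP6` is `norm_sub_le_of_expUnit_conj`.
Output: the hypotheses of `norm_covD_newPot_le` with `a = ξ·(5/2)α₂`, `a′ = ξα₁`, and the final budget `(1 + 3(a + a′))(d₁ + d₂) < α₁`
(numerically `≤ 0.83·α₁` at the corner `8α₂ = α₁ = 1/16`, `ξ = 1`). -/
theorem budget313 {ξ α₁ α₂ nA nA' nB' dB d₁ d₂ nAt nAt' κ : ℝ}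
    (hξ : 0 < ξ) (hξ1 : ξ ≤ 1) (hres : 8 * α₂ ≤ α₁) (hα₁ : 16 * α₁ ≤ 1)
    (hnA0 : 0 ≤ nA) (hnA : nA < α₂) (hnA' : nA' < 1 / 2 * α₁)
    (hnB' : nB' < 1 / 2 * α₁) (hdB0 : 0 ≤ dB) (hdB : dB < α₂) (hd₁0 : 0 ≤ d₁) (hd₂0 : 0 ≤ d₂)
    (hd₂ : d₂ < 1 / 2 * α₁) (hκ0 : 0 ≤ κ) (hκ1 : κ ≤ 2 * (2 * (ξ * nB')))
    (hP6 : ξ * d₁ ≤ ξ * dB + (κ + 1) * κ * (nA + ξ * dB))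
    (hnAt : nAt ≤ nA + ξ * d₁) (hnAt' : nAt' ≤ nA' + ξ * d₂) :
    ξ * nA ≤ ξ * (5 / 2 * α₂) ∧ ξ * nAt ≤ ξ * (5 / 2 * α₂) ∧ ξ * nA' ≤ ξ * α₁ ∧ ξ * nAt' ≤ ξ * α₁ ∧
      ξ * (5 / 2 * α₂) + ξ * α₁ ≤ 1 / 8 ∧
      ∀ g : ℝ, g ≤ (1 + 3 * (ξ * (5 / 2 * α₂) + ξ * α₁)) * (d₁ + d₂) → g < α₁ := by
  have hα₂0 : 0 ≤ α₂ := by linarith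
  have hα₁0 : 0 ≤ α₁ := by linarith
  have hξnB' : ξ * nB' ≤ ξ * (1 / 2 * α₁) := mul_le_mul_of_nonneg_left hnB'.le hξ.le
  have hξα₁ : ξ * α₁ ≤ 1 * α₁ := mul_le_mul_of_nonneg_right hξ1 hα₁0
  have hκ2 : κ ≤ 2 * ξ * α₁ := by linarith
  have hκ3 : κ ≤ 1 / 8 := by linarith
  have hξdB : ξ * dB ≤ ξ * α₂ := mul_le_mul_of_nonneg_left hdB.le hξ.le
  have hξα₂ : ξ * α₂ ≤ 1 * α₂ := mul_le_mul_of_nonneg_right hξ1 hα₂0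
  have hx : nA + ξ * dB ≤ 2 * α₂ := by linarith
  have hprod : (κ + 1) * κ * (nA + ξ * dB) ≤ 9 / 8 * (2 * ξ * α₁) * (2 * α₂) :=
    mul_le_mul (mul_le_mul (by linarith) hκ2 hκ0 (by norm_num)) hx (add_nonneg hnA0 (mul_nonneg hξ.le hdB0))
      (mul_nonneg (by norm_num) (mul_nonneg (mul_nonneg (by norm_num) hξ.le) hα₁0))
  have h1 : ξ * d₁ ≤ ξ * (α₂ * (1 + 9 / 2 * α₁)) := by linarith
  have hd₁ : d₁ ≤ α₂ * (1 + 9 / 2 * α₁) := le_of_mul_le_mul_left h1 hξ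
  have hξd₁ : ξ * d₁ ≤ 1 * d₁ := mul_le_mul_of_nonneg_right hξ1 hd₁0
  have hξd₂ : ξ * d₂ ≤ 1 * d₂ := mul_le_mul_of_nonneg_right hξ1 hd₂0
  have hα₁α₂ : α₂ * α₁ ≤ α₂ * (1 / 16) := mul_le_mul_of_nonneg_left (by linarith) hα₂0
  have hAt_le : nAt ≤ 5 / 2 * α₂ := by linarith
  have hAt'_le : nAt' ≤ α₁ := by linarith
  have hr0 : ξ * (5 / 2 * α₂ + α₁) ≤ 1 * (5 / 2 * α₂ + α₁) := mul_le_mul_of_nonneg_right hξ1 (by linarith)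
  refine ⟨mul_le_mul_of_nonneg_left (by linarith) hξ.le, mul_le_mul_of_nonneg_left hAt_le hξ.le,
    mul_le_mul_of_nonneg_left (by linarith) hξ.le, mul_le_mul_of_nonneg_left hAt'_le hξ.le, by linarith, ?_⟩
  intro g hg
  have hF1 : 3 * (ξ * (5 / 2 * α₂) + ξ * α₁) ≤ 63 / 256 := by linarith
  have hF2 : d₁ + d₂ < 169 / 256 * α₁ := by linarith
  have hF3 := mul_nonneg (sub_nonneg.mpr hF1) (add_nonneg hd₁0 hd₂0)
  nlinarith

/-- **B12 p. 272, the sentence before (3.14) («These restrictions can be easily obtained from the definition of the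
spaces» — i.e. of `U^c_j(X, α₀, α₁, γ₀)`, p. 262; the gloss is ours), condition (ii) of (1.13), at ONE bond
`b = ⟨x, x + ξe_μ⟩ ⊂ X` and its `ν`-neighbour `b₁ = b + ξe_ν`.**
Data (one submultiplicative complete normed `ℂ`-algebra `𝔸` for the matrix letters): `u ∈ 𝔸ˣ` the `G`-valued bond variable
`U(x, x + ξe_ν)` of the factor `U` of `𝐔 = U′U` (a unit, no size hypothesis); `B′ = A′_ν(x)`, so that the full transporter is
`𝐔(x, x + ξe_ν) = e^{iξB′}u`; `A = 𝐀(b)`, `A₁ = 𝐀(b₁)` the fluctuation field of (3.13)–(3.14); `A′ = A′(b)`, `A′₁ = A′(b₁)` the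
potential of `U′ = exp iξA′` ((1.13) for `𝐔 ∈ U^c_j(X, ½α₀, ½α₁, α₀)`).  Hypotheses = the print's: (1.13) with `½α₁`:
`|A′(b)|, |A′(b₁)|, |A′_ν(x)| < ½α₁`, `|(∇^ξ_U A′)(b)| = ξ⁻¹|uA′₁u⁻¹ − A′| < ½α₁`; (3.14): `|𝐀(b)|, |𝐀(b₁)| < α₂` and
`|(∇^ξ_{𝐔,ν}𝐀)(b)| = ξ⁻¹|(e^{iξB′}u)A₁(e^{iξB′}u)⁻¹ − A| < α₂` (the derivative covariant w.r.t. the FULL `𝐔`, as printed);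
restriction `8α₂ ≤ α₁`, `16α₁ ≤ 1`, `0 < ξ ≤ 1`.  Conclusion: the new `U′`-factor `exp iξA″`, `A″ = newPot ξ 𝐀 A′`, of
`exp iξ𝐀·𝐔 = (e^{iξ𝐀}e^{iξA′})·U` satisfies (1.13) with `α₁` at `b`: `e^{iξA″} = e^{iξ𝐀}e^{iξA′}` (at `b` and `b₁`),
`|A″(b)| < α₁`, `|(∇^ξ_U A″)(b)| = ξ⁻¹|uA″₁u⁻¹ − A″| < α₁`.
[cite: Balaban1987RG1, p. 272 (sentence before (3.14)) with (1.13) p. 262 and (3.14) p. 272 — condition (ii); the proof and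
the admissible restriction `8α₂ ≤ α₁ ≤ 1/16` are ours (the print: «α₂, depending on α₀ and on some absolute constants»; here the
dependence is on `α₁`, as in the hand certificate GAPS G-adv9-2 (ii) «α₂ < ½α₁ − O(ξα₁²)»).] -/
theorem condII_expMul {ξ α₁ α₂ : ℝ} (hξ : 0 < ξ) (hξ1 : ξ ≤ 1) (hres : 8 * α₂ ≤ α₁) (hα₁ : 16 * α₁ ≤ 1)
    (u : 𝔸ˣ) (B' A A₁ A' A'₁ : 𝔸)
    (hA' : ‖A'‖ < 1 / 2 * α₁) (hA'₁ : ‖A'₁‖ < 1 / 2 * α₁) (hB' : ‖B'‖ < 1 / 2 * α₁)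
    (hDA' : ‖(ξ : ℂ)⁻¹ • ((u : 𝔸) * A'₁ * ↑u⁻¹ - A')‖ < 1 / 2 * α₁)
    (hA : ‖A‖ < α₂) (hA₁ : ‖A₁‖ < α₂)
    (hDA : ‖(ξ : ℂ)⁻¹ • ((↑(Beta.BackgroundVertices.expUnit ℂ ((I * ξ) • B') * u) : 𝔸) * A₁ *
        ↑(Beta.BackgroundVertices.expUnit ℂ ((I * ξ) • B') * u)⁻¹ - A)‖ < α₂) :
    exp ((I * ξ) • newPot ξ A A') = exp ((I * ξ) • A) * exp ((I * ξ) • A') ∧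
    exp ((I * ξ) • newPot ξ A₁ A'₁) = exp ((I * ξ) • A₁) * exp ((I * ξ) • A'₁) ∧
    ‖newPot ξ A A'‖ < α₁ ∧
    ‖(ξ : ℂ)⁻¹ • ((u : 𝔸) * newPot ξ A₁ A'₁ * ↑u⁻¹ - newPot ξ A A')‖ < α₁ := by
  have hα₂0 : 0 ≤ α₂ := (norm_nonneg _).trans hA.le
  have nA0 := norm_nonneg A
  have nA'0 := norm_nonneg A'
  have nA₁0 := norm_nonneg A₁
  have nA'₁0 := norm_nonneg A'₁
  have nB'0 := norm_nonneg B'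
  -- smallness of `w = e^{iξ𝐀}e^{iξA′} − 1` at both bonds
  have hw : ‖exp ((I * ξ) • A) * exp ((I * ξ) • A') - 1‖ < 1 :=
    norm_expMul_sub_one_lt_one (by rw [norm_I_mul_smul hξ.le, norm_I_mul_smul hξ.le]; nlinarith)
  have hw₁ : ‖exp ((I * ξ) • A₁) * exp ((I * ξ) • A'₁) - 1‖ < 1 :=
    norm_expMul_sub_one_lt_one (by rw [norm_I_mul_smul hξ.le, norm_I_mul_smul hξ.le]; nlinarith)
  refine ⟨exp_smul_newPot hξ.ne' hw, exp_smul_newPot hξ.ne' hw₁, ?_, ?_⟩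
  · -- `|A″| < α₁`
    have h := norm_newPot_le hξ (A := A) (A' := A') (by nlinarith)
    have hs : ‖A‖ + ‖A'‖ < 5 / 8 * α₁ := by linarith
    have hs2 : (‖A‖ + ‖A'‖) ^ 2 ≤ (5 / 8 * α₁) ^ 2 := pow_le_pow_left₀ (by positivity) hs.le 2
    have hα₁sq : α₁ ^ 2 ≤ α₁ * (1 / 16) := by nlinarith
    calc ‖newPot ξ A A'‖ ≤ ‖A‖ + ‖A'‖ + 3 * ξ * (‖A‖ + ‖A'‖) ^ 2 := h
      _ ≤ ‖A‖ + ‖A'‖ + 3 * 1 * (‖A‖ + ‖A'‖) ^ 2 := by gcongr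
      _ < α₁ := by nlinarith
  · -- `|∇^ξ_U A″| < α₁`
    have key : ∀ a a' : ℝ, ξ * ‖A‖ ≤ a → ξ * ‖(u : 𝔸) * A₁ * ↑u⁻¹‖ ≤ a → ξ * ‖A'‖ ≤ a' →
        ξ * ‖(u : 𝔸) * A'₁ * ↑u⁻¹‖ ≤ a' → a + a' ≤ 1 / 8 →
        ‖(ξ : ℂ)⁻¹ • ((u : 𝔸) * newPot ξ A₁ A'₁ * ↑u⁻¹ - newPot ξ A A')‖ ≤
          (1 + 3 * (a + a')) *
            (‖(ξ : ℂ)⁻¹ • ((u : 𝔸) * A₁ * ↑u⁻¹ - A)‖ + ‖(ξ : ℂ)⁻¹ • ((u : 𝔸) * A'₁ * ↑u⁻¹ - A')‖) :=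
      fun a a' h₁ h₂ h₃ h₄ hr => norm_covD_newPot_le u hξ hw₁ h₁ h₂ h₃ h₄ hr
    have hTform : ((↑(Beta.BackgroundVertices.expUnit ℂ ((I * ξ) • B') * u) : 𝔸) * A₁ *
          ↑(Beta.BackgroundVertices.expUnit ℂ ((I * ξ) • B') * u)⁻¹) =
        (Beta.BackgroundVertices.expUnit ℂ ((I * ξ) • B') : 𝔸) * ((u : 𝔸) * A₁ * ↑u⁻¹) *
          ↑(Beta.BackgroundVertices.expUnit ℂ ((I * ξ) • B'))⁻¹ := by
      simp only [mul_inv_rev, Units.val_mul, mul_assoc]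
    rw [hTform] at hDA
    have hP6 := norm_sub_le_of_expUnit_conj ((I * ξ) • B') ((u : 𝔸) * A₁ * ↑u⁻¹) A
    rw [norm_I_mul_smul hξ.le] at hP6
    set At := (u : 𝔸) * A₁ * ↑u⁻¹ with hAt
    set At' := (u : 𝔸) * A'₁ * ↑u⁻¹ with hAt'
    set T := (Beta.BackgroundVertices.expUnit ℂ ((I * ξ) • B') : 𝔸) * At *
      ↑(Beta.BackgroundVertices.expUnit ℂ ((I * ξ) • B'))⁻¹ with hT
    have eDB : ‖T - A‖ = ξ * ‖(ξ : ℂ)⁻¹ • (T - A)‖ := norm_eq_mul_norm_inv_smul hξ _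
    have eD₁ : ‖At - A‖ = ξ * ‖(ξ : ℂ)⁻¹ • (At - A)‖ := norm_eq_mul_norm_inv_smul hξ _
    have eD₂ : ‖At' - A'‖ = ξ * ‖(ξ : ℂ)⁻¹ • (At' - A')‖ := norm_eq_mul_norm_inv_smul hξ _
    have hnAt : ‖At‖ ≤ ‖A‖ + ξ * ‖(ξ : ℂ)⁻¹ • (At - A)‖ := by
      have h := norm_le_norm_add_norm_sub' At A; rwa [eD₁] at h
    have hnAt' : ‖At'‖ ≤ ‖A'‖ + ξ * ‖(ξ : ℂ)⁻¹ • (At' - A')‖ := by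
      have h := norm_le_norm_add_norm_sub' At' A'; rwa [eD₂] at h
    set dB := ‖(ξ : ℂ)⁻¹ • (T - A)‖ with hdB
    set d₁ := ‖(ξ : ℂ)⁻¹ • (At - A)‖ with hd₁
    set d₂ := ‖(ξ : ℂ)⁻¹ • (At' - A')‖ with hd₂
    -- `κ = e^{2ξ|B′|} − 1 ≤ 4ξ|B′|`
    set κ := Real.exp (2 * (ξ * ‖B'‖)) - 1 with hκ
    have hx0 : 0 ≤ 2 * (ξ * ‖B'‖) := by positivity
    have hκ0 : 0 ≤ κ := by have := Real.add_one_le_exp (2 * (ξ * ‖B'‖)); linarith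
    have hκ1 : κ ≤ 2 * (2 * (ξ * ‖B'‖)) := by
      have hx1 : 2 * (ξ * ‖B'‖) ≤ 1 := by
        have : ξ * ‖B'‖ ≤ 1 * ‖B'‖ := mul_le_mul_of_nonneg_right hξ1 nB'0
        linarith
      have h2 : |2 * (ξ * ‖B'‖)| ≤ 1 := by rwa [abs_of_nonneg hx0]
      have := Real.abs_exp_sub_one_le h2
      rw [abs_of_nonneg hx0] at this
      linarith [le_abs_self (Real.exp (2 * (ξ * ‖B'‖)) - 1)]
    have hexp : Real.exp (2 * (ξ * ‖B'‖)) = κ + 1 := by rw [hκ]; ring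
    rw [eDB, eD₁, hexp] at hP6
    have dB0 : 0 ≤ dB := norm_nonneg _
    have d₁0 : 0 ≤ d₁ := norm_nonneg _
    have d₂0 : 0 ≤ d₂ := norm_nonneg _
    clear_value At At' T dB d₁ d₂ κ
    obtain ⟨h₁, h₂, h₃, h₄, hr, hfin⟩ := budget313 hξ hξ1 hres hα₁ nA0 hA hA' hB' dB0 hDA d₁0 d₂0 hDA' hκ0 hκ1
      hP6 hnAt hnAt'
    exact hfin _ (key _ _ h₁ h₂ h₃ h₄ hr)

/-- **Lattice form of `condII_expMul`** in the vocabulary of `B8CurlGradHolonomy` (`covD`, `adT`): bond fields as components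
`Aμ, A′μ, A′ν : S → 𝔸` on a site type `S` with the shift `sν = (· + ξe_ν)`, `G`-valued transporters `Uν : S → 𝔸ˣ`, full
transporters `𝐔_ν = e^{iξA′_ν}·U_ν`; `(∇^ξ_{U,ν}f)(x) = ξ⁻¹·covD sν (adT Uν) f x = ξ⁻¹(U_ν(x) f(x+ξe_ν) U_ν(x)⁻¹ − f(x))`.
If (1.13) with `½α₁` holds for `A′` at `x` (components `A′_μ(x)`, `A′_μ(x+ξe_ν)`, `A′_ν(x)`, `∇^ξ_{U,ν}A′_μ(x)`) and (3.14)
holds for `𝐀_μ` at `x` (`𝐀_μ(x)`, `𝐀_μ(x+ξe_ν)`, `∇^ξ_{𝐔,ν}𝐀_μ(x)`), and `8α₂ ≤ α₁ ≤ 1/16`, `0 < ξ ≤ 1`, then the new potential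
`A″_μ = newPot ξ 𝐀_μ A′_μ` satisfies `|A″_μ(x)| < α₁`, `|∇^ξ_{U,ν}A″_μ(x)| < α₁`.
[cite: Balaban1987RG1, p. 272 sentence before (3.14) with (1.13) p. 262 — condition (ii), lattice transcription; proof ours] -/
theorem condII_covD_expMul {S : Type*} (sν : S → S) (Uν : S → 𝔸ˣ) (A'ν Aμ A'μ : S → 𝔸) (x : S)
    {ξ α₁ α₂ : ℝ} (hξ : 0 < ξ) (hξ1 : ξ ≤ 1) (hres : 8 * α₂ ≤ α₁) (hα₁ : 16 * α₁ ≤ 1)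
    (hA' : ‖A'μ x‖ < 1 / 2 * α₁) (hA'₁ : ‖A'μ (sν x)‖ < 1 / 2 * α₁) (hB' : ‖A'ν x‖ < 1 / 2 * α₁)
    (hDA' : ‖(ξ : ℂ)⁻¹ • B8CurlGradHolonomy.covD sν (B8CurlGradHolonomy.adT Uν) A'μ x‖ < 1 / 2 * α₁)
    (hA : ‖Aμ x‖ < α₂) (hA₁ : ‖Aμ (sν x)‖ < α₂)
    (hDA : ‖(ξ : ℂ)⁻¹ • B8CurlGradHolonomy.covD sν
        (B8CurlGradHolonomy.adT (fun y => Beta.BackgroundVertices.expUnit ℂ ((I * ξ) • A'ν y) * Uν y)) Aμ x‖ < α₂) :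
    ‖newPot ξ (Aμ x) (A'μ x)‖ < α₁ ∧
    ‖(ξ : ℂ)⁻¹ • B8CurlGradHolonomy.covD sν (B8CurlGradHolonomy.adT Uν) (fun y => newPot ξ (Aμ y) (A'μ y)) x‖ < α₁ := by
  rw [B8CurlGradHolonomy.covD_adT_apply] at hDA' hDA ⊢
  have h := condII_expMul hξ hξ1 hres hα₁ (Uν x) (A'ν x) (Aμ x) (Aμ (sν x)) (A'μ x) (A'μ (sν x))
    hA' hA'₁ hB' hDA' hA hA₁ hDA
  exact ⟨h.2.2.1, h.2.2.2⟩

end Literature.MathematicalPhysics.QuantumFieldTheory.Balaban1983to89.B12Membership313II
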